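import Summits.HubbardSuperconductivity.HubbardLadder.Bounds.StrongCouplingStiffnessCeiling
import Summits.HubbardSuperconductivity.HubbardLadder.Bounds.StiffnessFromEnergyBracketsTPrime
import Literature.MathematicalPhysics.QuantumLattice.HubbardNNNHoppingHoleCounting
import HarnessLib

/-!
# Hubbard ladder — Bounds: strong-coupling stiffness ceilings, part 2 — the `t–t'` class
# (bounds.tex Thm 7(vii)–(x): `limsup_{U→∞} ρ_s ≤ (|t| + 2|t'|)·n_h`, typed AND proved)

HONEST FRAMING (cell pub-hubbard): ladder R1–R4 with certified numbers; no claim on H/H₀. These are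
bounds for a MODEL CLASS — the `t–t'` Hubbard torus `hubbardTorusTT' L 1 t' U` on `(ℤ/L)²`, `T = 0`,
every filling at or below half filling, EVERY real `t'` — and no materials claim. Companion text:
`pub-hubbard/paper/bounds.tex` §7 (Theorem 7 (vii)–(x)); table `pub-hubbard-bounds/BOUNDS.md` row T5.

Part 1 (`StrongCouplingStiffnessCeiling.lean`) treats `t' = 0`. Here the diagonal hopping is added. Two
observations make the `t' = 0` argument go through unchanged: (a) the `x`-twist floor of the `t–t'`
torus is `ρ_s L² ≤ K_x(ψ) + t' K_d(ψ)` (tree: `stiffnessTT'_mul_sq_le_kinetic_of_isGroundStateInSector`;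
every diagonal bond crosses the seam), so that for a unit sector ground state `ψ` and its rotation
`φ = Γ(r)ψ`, `2ρ_s L² ≤ (K_x + K_y)(φ) + 2t'K_d(φ) = -Re⟨φ, H^{t,2t'}(U = 0) φ⟩`; and (b) the
Nagaoka–Brinkman–Rice hole/doublon counting inequality holds for the `t–t'` torus with `z(|t| + |t'|)`
in place of `z|t|` (`Literature/…/HubbardNNNHoppingHoleCounting.lean`:
`holeCounting_le_re_expect_hubbardTorusTT'`, the diagonal graph also having maximal degree `4`), whence —
applied at hopping `(1, 2t')` and `U = 0` — `2ρ_s L² ≤ (2 + 4|t'|)((L² - N) + ωL² + (2 + 2ω⁻¹)D(φ))`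
for EITHER sign of `t'`, and `D(φ)` is controlled by the chord in `U` exactly as before. The two energy
brackets of the closed form are the Literature file's `E^{tt'} ≤ 0` (doublon-free configuration) and
`E^{tt'} ≥ -4(1 + |t'|)((L² - N_L) + ω₁L²)` (counting floor).

## What is proved (no `sorry`, no new axioms; `τ := 1 + |t'|`, `τ₂ := 1 + 2|t'|`, `n_h = (L² - N_L)/L²`)

* `HoleDoublonStiffnessCeilingTT'` — bracket form: `ρ_s L² ≤ τ₂((L² - N_L) + ωL² + (2+2ω⁻¹)(R - L₁)/(U - U₁))`
  for all brackets `E^{tt'}_L(U) ≤ R`, `L₁ ≤ E^{tt'}_L(U₁)`, `U₁ < U`, `ω > 0`, every `δ ≥ -1`.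
* `StrongCouplingStiffnessCeilingTT'` — closed form, `δ ≥ 0`, `8τ < U₁ < U`:
  `ρ_s ≤ τ₂ (n_h + ω + (2 + 2ω⁻¹)(4τ n_h + 32τ²/(U₁ - 8τ))/(U - U₁))`, from `R = 0`
  (Literature `minEnergyOn_szSector_hubbardTorusTT'_le_zero`) and the counting floor
  `L₁ = -4τ((L² - N_L) + ω₁L²)`, `ω₁ = 8τ/(U₁ - 8τ)` (Literature `hubbardTorusTT'_holeCounting_floor`).
* `StrongCouplingStiffnessCeilingTT'TL` — the same with `n_h → δ` along `L → ∞` (even `L`).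
* `InfiniteUStiffnessLimsupTT'` — for every `t'` and `ε > 0` there is `U₀` with `ρ_s ≤ τ₂ n_h + ε` for
  all `L ≥ 3`, `U ≥ U₀`, `δ ≥ 0`: **`limsup_{U→∞} ρ_s ≤ (|t| + 2|t'|) n_h`** uniformly in the volume and
  the filling — `|t| + 2|t'|` is the maximal `x`-curvature `½ ∂²ε/∂k_x²` of the band
  `ε(k) = -2t(cos k_x + cos k_y) - 4t' cos k_x cos k_y`, the one-hole (Nagaoka) scale.
* `strongCouplingStiffnessCeiling_of_TT'` — consistency: at `t' = 0` the node is part 1's.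

Numbers (`t = 1`, `t' = -1/4`, so `τ = 5/4`, `τ₂ = 3/2`): `limsup_{U→∞} ρ_s ≤ 1.5 n_h`; the closed form
is below the one-body half-filling value `kinL1(-1/4)/4` only for `U` of order `10²` — like part 1, the
content is the `U → ∞` statement, not the crossover.

References (keys of `lean/references.bib`): Nagaoka1966 §II; BrinkmanRice1970; Tasaki1998 §3.2, §6.3;
HazraVermaRanderia2019 §III, App. G; ParamekantiTrivediRanderia1998 eq. (3); XuEtAl2024 eq. (1) (the
`t–t'` torus).
-/

noncomputable section

namespace Summit.HubbardSuperconductivity.HubbardLadder.Bounds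

open Matrix Finset Real Filter Topology
open Literature.MathematicalPhysics.QuantumLattice
open Literature.MathematicalPhysics.QuantumFieldTheory
open Literature.Probability.LatticeModels
open Literature.MathematicalPhysics.QuantumLattice.ThermodynamicLimit
open scoped ComplexOrder ComplexConjugate Topology

variable {L : ℕ} [NeZero L]

/-! ### Counting bounds for the `t–t'` class -/

/-- **Counting bound, `t–t'` class**: for an `N`-particle unit vector `φ` (`L ≥ 3`), every `t'` and
`ω > 0`, `(K_x + K_y)(φ) + 2t'K_d(φ) ≤ (2 + 4|t'|)((L² - N) + ωL² + (2 + 2ω⁻¹)D(φ))` — the Literature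
counting inequality for the hopping `(t, t') = (1, 2t')` at `U = 0`. -/
theorem kinWeightTT'_le_holeDoublon (hL : 3 ≤ L) (t' : ℝ) {ω : ℝ} (hω : 0 < ω) {N : ℕ}
    {φ : Fock (Orb (FermionTorus 2 L))} (hN : IsNParticle N φ) (h1 : star φ ⬝ᵥ φ = 1) :
    kinWeightDir 0 φ + kinWeightDir 1 φ + 2 * t' * kinWeightDiag φ ≤
      (2 + 4 * |t'|) * (((L : ℝ) ^ 2 - N) + ω * (L : ℝ) ^ 2 + (2 + 2 * ω⁻¹) * doubleOccExp φ) := by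
  have h := holeCounting_le_re_expect_hubbardTorusTT' 1 (2 * t') 0 hω hN h1
  have hD : (star φ ⬝ᵥ ((∑ x : FermionTorus 2 L, numberOp x 0 * numberOp x 1) *ᵥ φ)).re =
      doubleOccExp φ := rfl
  rw [re_expect_hubbardTorusTT'_eq_kin hL (2 * t') 0 φ, hD, abs_one, abs_mul, abs_two] at h
  have hDnn : 0 ≤ doubleOccExp φ := by
    rw [← hD, re_expect_interaction_eq_sum]
    positivity
  nlinarith [abs_nonneg t', hDnn, inv_pos.2 hω]

/-! ### Node 1 — the bracket form -/

/-- **Thm 7(vii) (hole–doublon stiffness ceiling, `t–t'` class, bracket form).** `L ≥ 3`, any real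
`t'`, `U₁ < U`, `-1 ≤ δ`, `ω > 0`; `ρ_s > 0` a flux stiffness of the `(N_L, S^z = 0)` sector of
`hubbardTorusTT' L 1 t' U` (`ρ_s θ² ≤ E^{tt'}(θ) - E^{tt'}(0)` for `|θ| ≤ θ₀`); brackets
`E^{tt'}_L(U) ≤ R`, `L₁ ≤ E^{tt'}_L(U₁)`. Then
`ρ_s L² ≤ (1 + 2|t'|)((L² - N_L) + ωL² + (2 + 2ω⁻¹)(R - L₁)/(U - U₁))`.
kind: support (PROVED below). Why it might fail: it cannot; it is loose when `D(ψ)` is. Sources: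
HazraVermaRanderia2019 §III; Nagaoka1966; XuEtAl2024 eq. (1); this cell (part 1). -/
@[conjecture] def HoleDoublonStiffnessCeilingTT' : Prop :=
  ∀ (L : ℕ) [NeZero L], 3 ≤ L → ∀ (t' U U₁ δ ρs θ₀ ω : ℝ), -1 ≤ δ → U₁ < U → 0 < ρs → 0 < θ₀ →
    0 < ω → (∀ θ : ℝ, |θ| ≤ θ₀ → ρs * θ ^ 2 ≤ fluxEnergyTT' L t' U δ θ - fluxEnergyTT' L t' U δ 0) →
    ∀ (R L₁ : ℝ), fluxEnergyTT' L t' U δ 0 ≤ R → L₁ ≤ fluxEnergyTT' L t' U₁ δ 0 →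
      ρs * (L : ℝ) ^ 2 ≤ (1 + 2 * |t'|) * (((L : ℝ) ^ 2 - (rectN (1 - δ) L : ℕ)) + ω * (L : ℝ) ^ 2 +
        (2 + 2 * ω⁻¹) * ((R - L₁) / (U - U₁)))

/-- **Proof of `HoleDoublonStiffnessCeilingTT'`**: `x`-twist floors `ρ_s L² ≤ K_x + t'K_d` on `ψ` and
`Γ(r)ψ`, the `t–t'` counting bound for `Γ(r)ψ`, and the chord bound on `D`. -/
theorem holeDoublonStiffnessCeilingTT'_holds : HoleDoublonStiffnessCeilingTT' := by
  intro L _ hL t' U U₁ δ ρs θ₀ ω hδ hU₁ hρs hθ₀ hω hst R L₁ hR hL₁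
  obtain ⟨ψ, h1, hgs⟩ := exists_unit_groundStateInSector_hubbardTorusTT' L 1 t' U
    (NoGo.floor_pairNumber_le δ hδ L)
  set φ : Fock (Orb (FermionTorus 2 L)) :=
    fockMapOp (d4Orb (DihedralGroup.r 1 : DihedralGroup 4)) *ᵥ ψ with hφ_def
  have hφgs : IsGroundStateInSector (hubbardTorusTT' L 1 t' U) (2 * ⌊(1 - δ) * (L : ℝ) ^ 2 / 2⌋₊) 0 φ :=
    isGroundStateInSector_hubbardTorusTT'_rot hgs
  have hφ1 : star φ ⬝ᵥ φ = 1 := by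
    rw [hφ_def, star_fockMapOp_mulVec_dotProduct_self _ (d4Orb_bijective _).injective, h1]
  have hKy : kinWeightDir 1 φ = kinWeightDir 0 ψ := kinWeightDir_one_rot ψ
  have hKd : kinWeightDiag φ = kinWeightDiag ψ := kinWeightDiag_rot ψ
  have hfψ : ρs * (L : ℝ) ^ 2 ≤ kinWeightDir 0 ψ + t' * kinWeightDiag ψ := by
    have h := stiffnessTT'_mul_sq_le_kinetic_of_isGroundStateInSector hL t' U δ hρs hθ₀ hst hgs h1
    rw [sum_shiftKinWeight_eq_kinWeightDiag] at h
    refine h.trans (le_of_eq ?_)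
    rfl
  have hfφ : ρs * (L : ℝ) ^ 2 ≤ kinWeightDir 0 φ + t' * kinWeightDiag φ := by
    have h := stiffnessTT'_mul_sq_le_kinetic_of_isGroundStateInSector hL t' U δ hρs hθ₀ hst hφgs hφ1
    rw [sum_shiftKinWeight_eq_kinWeightDiag] at h
    refine h.trans (le_of_eq ?_)
    rfl
  rw [← hKy, ← hKd] at hfψ
  -- the counting bound for `φ`
  have hN : IsNParticle (2 * ⌊(1 - δ) * (L : ℝ) ^ 2 / 2⌋₊) φ := ((mem_szSector_iff _ _ φ).1 hφgs.1).1
  have hcount := kinWeightTT'_le_holeDoublon hL t' hω hN hφ1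
  -- the chord bound on `D(φ)`
  have hchord := sectorEnergyTT'_le_add_mul_doubleOccExp hφgs hφ1 U₁
  rw [fluxEnergyTT'_zero_eq_sectorEnergyTT' (L := L) t' U δ] at hR
  rw [fluxEnergyTT'_zero_eq_sectorEnergyTT' (L := L) t' U₁ δ] at hL₁
  have hUU : 0 < U - U₁ := sub_pos.2 hU₁
  have hD : doubleOccExp φ ≤ (R - L₁) / (U - U₁) := by
    rw [le_div_iff₀ hUU]; linarith
  have hc : (0 : ℝ) ≤ (2 + 4 * |t'|) * (2 + 2 * ω⁻¹) := by positivity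
  have hcD := mul_le_mul_of_nonneg_left hD hc
  have hrect : ((rectN (1 - δ) L : ℕ) : ℝ) = ((2 * ⌊(1 - δ) * (L : ℝ) ^ 2 / 2⌋₊ : ℕ) : ℝ) := by
    rw [rectN]
  rw [hrect]
  nlinarith [hfψ, hfφ, hcount, hcD, abs_nonneg t']

/-! ### Node 2 — closed form at or below half filling -/

/-- Arithmetic: divide the finite-volume ceiling by `L² > 0`. -/
private theorem div_sq_form' {ρ S a h ω c p q W : ℝ} (hS : 0 < S) (hW : W ≠ 0)
    (H : ρ * S ≤ a * (h + ω * S + c * ((p * h + q * S) / W))) :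
    ρ ≤ a * (h / S + ω + c * ((p * (h / S) + q) / W)) := by
  have key : a * (h / S + ω + c * ((p * (h / S) + q) / W)) * S =
      a * (h + ω * S + c * ((p * h + q * S) / W)) := by
    field_simp
  exact le_of_mul_le_mul_right (H.trans_eq key.symm) hS

/-- **Thm 7(viii) (strong-coupling stiffness ceiling, `t–t'` class, closed form).** `L ≥ 3`, any real
`t'`, `τ := 1 + |t'|`, `0 ≤ δ`, `8τ < U₁ < U`, `ω > 0`, `ρ_s > 0` a flux stiffness of the `(N_L, S^z = 0)`
sector of `hubbardTorusTT' L 1 t' U`. Then, with `n_h = holeDensity L δ`,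
`ρ_s ≤ (1 + 2|t'|)(n_h + ω + (2 + 2ω⁻¹)(4τ n_h + 32τ²/(U₁ - 8τ))/(U - U₁))`.
kind: support (PROVED below). Why it might fail: it cannot. Sources: Nagaoka1966;
HazraVermaRanderia2019 §III; this cell. -/
@[conjecture] def StrongCouplingStiffnessCeilingTT' : Prop :=
  ∀ (L : ℕ) [NeZero L], 3 ≤ L → ∀ (t' U U₁ δ ρs θ₀ ω : ℝ), 0 ≤ δ → 8 * (1 + |t'|) < U₁ → U₁ < U →
    0 < ρs → 0 < θ₀ → 0 < ω →
    (∀ θ : ℝ, |θ| ≤ θ₀ → ρs * θ ^ 2 ≤ fluxEnergyTT' L t' U δ θ - fluxEnergyTT' L t' U δ 0) →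
      ρs ≤ (1 + 2 * |t'|) * (holeDensity L δ + ω + (2 + 2 * ω⁻¹) *
        ((4 * (1 + |t'|) * holeDensity L δ + 32 * (1 + |t'|) ^ 2 / (U₁ - 8 * (1 + |t'|))) / (U - U₁)))

/-- **Proof of `StrongCouplingStiffnessCeilingTT'`** (`R = 0`, `L₁ =` counting floor at `U₁` with
`ω₁ = 8τ/(U₁ - 8τ)`). -/
theorem strongCouplingStiffnessCeilingTT'_holds : StrongCouplingStiffnessCeilingTT' := by
  intro L _ hL t' U U₁ δ ρs θ₀ ω hδ hU₁8 hU₁ hρs hθ₀ hω hst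
  have hδ' : (-1 : ℝ) ≤ δ := by linarith
  have hL2 : (0 : ℝ) < (L : ℝ) ^ 2 := by have := NeZero.pos L; positivity
  set τ : ℝ := 1 + |t'| with hτ_def
  have hτ : 0 < τ := by positivity
  -- `R = 0`
  have hR : fluxEnergyTT' L t' U δ 0 ≤ 0 := by
    rw [fluxEnergyTT'_zero_eq_sectorEnergyTT']
    exact minEnergyOn_szSector_hubbardTorusTT'_le_zero (L := L) t' U (two_mul_natFloor_le_sq hδ L)
  -- `L₁` = counting floor at `U₁`, `ω₁ = 8τ/(U₁ - 8τ)`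
  set ω₁ : ℝ := 8 * τ / (U₁ - 8 * τ) with hω₁_def
  have hU₁8' : 0 < U₁ - 8 * τ := sub_pos.2 hU₁8
  have hω₁ : 0 < ω₁ := div_pos (by positivity) hU₁8'
  have hU₁eq : (|(1 : ℝ)| + |t'|) * (8 + 8 * ω₁⁻¹) ≤ U₁ := by
    rw [abs_one, ← hτ_def, hω₁_def, inv_div]
    have : τ * (8 + 8 * ((U₁ - 8 * τ) / (8 * τ))) = U₁ := by field_simp; ring
    exact this.le
  obtain ⟨ψ₁, h1, hgs₁⟩ := exists_unit_groundStateInSector_hubbardTorusTT' L 1 t' U₁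
    (NoGo.floor_pairNumber_le δ hδ' L)
  have hL₁ : -(4 * τ * (((L : ℝ) ^ 2 - (2 * ⌊(1 - δ) * (L : ℝ) ^ 2 / 2⌋₊ : ℕ)) + ω₁ * (L : ℝ) ^ 2)) ≤
      fluxEnergyTT' L t' U₁ δ 0 := by
    rw [fluxEnergyTT'_zero_eq_sectorEnergyTT']
    have h := hubbardTorusTT'_holeCounting_floor hω₁ hU₁eq _ 0 ⟨ψ₁, hgs₁.1, h1⟩
    rw [abs_one, ← hτ_def] at h
    exact h
  have h := holeDoublonStiffnessCeilingTT'_holds L hL t' U U₁ δ ρs θ₀ ω hδ' hU₁ hρs hθ₀ hω hst 0 _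
    hR hL₁
  have hrect : ((rectN (1 - δ) L : ℕ) : ℝ) = ((2 * ⌊(1 - δ) * (L : ℝ) ^ 2 / 2⌋₊ : ℕ) : ℝ) := by
    rw [rectN]
  rw [← hrect] at h
  have h4 : ∀ hh : ℝ, 0 - -(4 * τ * (hh + ω₁ * (L : ℝ) ^ 2)) =
      4 * τ * hh + 32 * τ ^ 2 / (U₁ - 8 * τ) * (L : ℝ) ^ 2 := by
    intro hh; rw [hω₁_def]; field_simp; ring
  rw [h4] at h
  have := div_sq_form' hL2 (sub_pos.2 hU₁).ne' h
  simpa only [holeDensity] using this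

/-- Consistency at `t' = 0`: part 1's closed form is the `t' = 0` case of the `t–t'` one. -/
theorem strongCouplingStiffnessCeiling_of_TT' (h : StrongCouplingStiffnessCeilingTT') :
    StrongCouplingStiffnessCeiling := by
  intro L _ hL U U₁ δ ρs θ₀ ω hδ hU₁8 hU₁ hρs hθ₀ hω hst
  have h' := h L hL 0 U U₁ δ ρs θ₀ ω hδ (by simpa using hU₁8) hU₁ hρs hθ₀ hω
    (by simpa only [fluxEnergyTT'_tPrime_zero] using hst)
  simp only [abs_zero, mul_zero, add_zero, one_mul, one_pow, mul_one] at h'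
  convert h' using 3

/-! ### Node 3 — thermodynamic-limit form -/

/-- A bound `ρ ≤ A + B/L²` along all large even `L` gives `ρ ≤ A`. -/
private theorem le_of_forall_even_sq' {ρ A B : ℝ} (L₀ : ℕ)
    (h : ∀ L : ℕ, L₀ ≤ L → 3 ≤ L → Even L → ρ ≤ A + B / (L : ℝ) ^ 2) : ρ ≤ A := by
  refine le_of_forall_pos_lt_add fun ε hε => ?_
  obtain ⟨m, hm⟩ := exists_nat_gt (B / ε)
  set L : ℕ := 2 * (m + L₀ + 3) with hLdef
  have hmL : (m : ℝ) ≤ (L : ℝ) ^ 2 := by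
    have h1 : (m : ℝ) ≤ L := by rw [hLdef]; push_cast; linarith [(Nat.cast_nonneg L₀ : (0:ℝ) ≤ L₀)]
    have h2 : (1 : ℝ) ≤ L := by rw [hLdef]; push_cast; linarith [(Nat.cast_nonneg m : (0:ℝ) ≤ m),
      (Nat.cast_nonneg L₀ : (0:ℝ) ≤ L₀)]
    nlinarith
  have hL2 : (0 : ℝ) < (L : ℝ) ^ 2 := by positivity
  have hBL : B / (L : ℝ) ^ 2 < ε := by
    rw [div_lt_iff₀ hL2]
    rw [div_lt_iff₀ hε] at hm
    nlinarith
  have := h L (by omega) (by omega) ⟨m + L₀ + 3, by omega⟩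
  linarith

/-- **Thm 7(ix) (`t–t'` class, thermodynamic limit).** If `ρ_s > 0` is a flux stiffness of the
`(N_L, S^z = 0)` sectors of `hubbardTorusTT' L 1 t' U` for all large even `L` (same `ρ_s, θ₀`), `0 ≤ δ`,
`8τ < U₁ < U` (`τ = 1 + |t'|`), `ω > 0`, then
`ρ_s ≤ (1 + 2|t'|)(δ + ω + (2 + 2ω⁻¹)(4τδ + 32τ²/(U₁ - 8τ))/(U - U₁))`.
kind: support (PROVED below). Why it might fail: it cannot. Sources: HazraVermaRanderia2019 §III;
this cell. -/
@[conjecture] def StrongCouplingStiffnessCeilingTT'TL : Prop :=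
  ∀ (t' U U₁ δ ρs θ₀ ω : ℝ) (L₀ : ℕ), 0 ≤ δ → 8 * (1 + |t'|) < U₁ → U₁ < U → 0 < ρs → 0 < θ₀ →
    0 < ω → (∀ (L : ℕ) [NeZero L], L₀ ≤ L → Even L →
      ∀ θ : ℝ, |θ| ≤ θ₀ → ρs * θ ^ 2 ≤ fluxEnergyTT' L t' U δ θ - fluxEnergyTT' L t' U δ 0) →
    ρs ≤ (1 + 2 * |t'|) * (δ + ω + (2 + 2 * ω⁻¹) *
      ((4 * (1 + |t'|) * δ + 32 * (1 + |t'|) ^ 2 / (U₁ - 8 * (1 + |t'|))) / (U - U₁)))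

/-- **Proof of `StrongCouplingStiffnessCeilingTT'TL`**: node 2 at every large even `L` with
`n_h ≤ δ + 2/L²`, then `L → ∞`. -/
theorem strongCouplingStiffnessCeilingTT'TL_holds : StrongCouplingStiffnessCeilingTT'TL := by
  intro t' U U₁ δ ρs θ₀ ω L₀ hδ hU₁8 hU₁ hρs hθ₀ hω hst
  set c : ℝ := 2 + 2 * ω⁻¹ with hc_def
  set τ : ℝ := 1 + |t'| with hτ_def
  set a : ℝ := 1 + 2 * |t'| with ha_def
  have hc : 0 ≤ c := by positivity
  have hτ : 0 ≤ τ := by positivity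
  have ha : 0 ≤ a := by positivity
  have hW : 0 < U - U₁ := sub_pos.2 hU₁
  refine le_of_forall_even_sq' (B := a * (2 * (1 + c * (4 * τ / (U - U₁))))) L₀
    fun L hL₀ hL3 hLe => ?_
  haveI : NeZero L := ⟨by omega⟩
  have h := strongCouplingStiffnessCeilingTT'_holds L hL3 t' U U₁ δ ρs θ₀ ω hδ hU₁8 hU₁ hρs hθ₀ hω
    (hst L hL₀ hLe)
  rw [← hc_def, ← hτ_def, ← ha_def] at h
  obtain ⟨-, -, hnh⟩ := holeDensity_bounds hδ L
  have hL2 : (0 : ℝ) < (L : ℝ) ^ 2 := by positivity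
  have hmono : a * (holeDensity L δ + ω + c * ((4 * τ * holeDensity L δ +
      32 * τ ^ 2 / (U₁ - 8 * τ)) / (U - U₁))) ≤ a * (δ + 2 / (L : ℝ) ^ 2 + ω +
      c * ((4 * τ * (δ + 2 / (L : ℝ) ^ 2) + 32 * τ ^ 2 / (U₁ - 8 * τ)) / (U - U₁))) := by
    refine mul_le_mul_of_nonneg_left ?_ ha
    have : c * ((4 * τ * holeDensity L δ + 32 * τ ^ 2 / (U₁ - 8 * τ)) / (U - U₁)) ≤
        c * ((4 * τ * (δ + 2 / (L : ℝ) ^ 2) + 32 * τ ^ 2 / (U₁ - 8 * τ)) / (U - U₁)) :=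
      mul_le_mul_of_nonneg_left (div_le_div_of_nonneg_right (by nlinarith) hW.le) hc
    linarith
  have key : a * (δ + 2 / (L : ℝ) ^ 2 + ω +
      c * ((4 * τ * (δ + 2 / (L : ℝ) ^ 2) + 32 * τ ^ 2 / (U₁ - 8 * τ)) / (U - U₁))) =
      a * (δ + ω + c * ((4 * τ * δ + 32 * τ ^ 2 / (U₁ - 8 * τ)) / (U - U₁))) +
        a * (2 * (1 + c * (4 * τ / (U - U₁)))) / (L : ℝ) ^ 2 := by
    field_simp
    ring
  linarith

/-! ### Node 4 — the `U → ∞` asymptotics -/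

/-- **Thm 7(x) (`limsup_{U→∞} ρ_s ≤ (|t| + 2|t'|) n_h` for the `t–t'` class, uniformly in the volume and
the filling).** For every real `t'` and `ε > 0` there is `U₀` such that for all `L ≥ 3`, `U ≥ U₀`, `δ ≥ 0`,
every flux stiffness `ρ_s > 0` of the `(N_L, S^z = 0)` sector of `hubbardTorusTT' L 1 t' U` satisfies
`ρ_s ≤ (1 + 2|t'|) n_h + ε`.
kind: support (PROVED below). Why it might fail: it cannot. Sources: Nagaoka1966;
HazraVermaRanderia2019 §III; this cell. -/
@[conjecture] def InfiniteUStiffnessLimsupTT' : Prop :=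
  ∀ (t' ε : ℝ), 0 < ε → ∃ U₀ : ℝ, ∀ (L : ℕ) [NeZero L], 3 ≤ L → ∀ (U δ ρs θ₀ : ℝ), U₀ ≤ U → 0 ≤ δ →
    0 < ρs → 0 < θ₀ →
    (∀ θ : ℝ, |θ| ≤ θ₀ → ρs * θ ^ 2 ≤ fluxEnergyTT' L t' U δ θ - fluxEnergyTT' L t' U δ 0) →
      ρs ≤ (1 + 2 * |t'|) * holeDensity L δ + ε

/-- **Proof of `InfiniteUStiffnessLimsupTT'`**: node 2 with `(1 + 2|t'|)ω = ε/2`, `U₁ = 40τ` and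
`U ≥ 40τ + 1 + 10 τ (1 + 2|t'|) c/ε`, `c = 2 + 2ω⁻¹`, using `0 ≤ n_h ≤ 1`. -/
theorem infiniteUStiffnessLimsupTT'_holds : InfiniteUStiffnessLimsupTT' := by
  intro t' ε hε
  set τ : ℝ := 1 + |t'| with hτ_def
  set a : ℝ := 1 + 2 * |t'| with ha_def
  have hτ : 1 ≤ τ := by rw [hτ_def]; linarith [abs_nonneg t']
  have ha : 1 ≤ a := by rw [ha_def]; linarith [abs_nonneg t']
  set ω : ℝ := ε / (2 * a) with hω_def
  have hω : 0 < ω := by positivity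
  set c : ℝ := 2 + 2 * ω⁻¹ with hc_def
  have hc : 0 < c := by positivity
  refine ⟨40 * τ + 1 + 10 * τ * a * c / ε, fun L _ hL U δ ρs θ₀ hU hδ hρs hθ₀ hst => ?_⟩
  have hpos : 0 < 10 * τ * a * c / ε := by positivity
  have hU₁ : 40 * τ < U := by linarith
  have hU₁8 : 8 * (1 + |t'|) < 40 * τ := by rw [hτ_def]; linarith [abs_nonneg t']
  have h := strongCouplingStiffnessCeilingTT'_holds L hL t' U (40 * τ) δ ρs θ₀ ω hδ hU₁8 hU₁ hρs
    hθ₀ hω hst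
  rw [← hτ_def, ← ha_def, ← hc_def] at h
  obtain ⟨h0, h1, -⟩ := holeDensity_bounds hδ L
  have hW : 0 < U - 40 * τ := by linarith
  have h32 : 32 * τ ^ 2 / (40 * τ - 8 * τ) = τ := by
    field_simp
    ring
  rw [h32] at h
  have hnum : 4 * τ * holeDensity L δ + τ ≤ 5 * τ := by nlinarith
  have hrem : c * ((4 * τ * holeDensity L δ + τ) / (U - 40 * τ)) ≤ c * (5 * τ / (U - 40 * τ)) :=
    mul_le_mul_of_nonneg_left (div_le_div_of_nonneg_right hnum hW.le) hc.le
  have hfin : a * (c * (5 * τ / (U - 40 * τ))) ≤ ε / 2 := by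
    rw [← mul_div_assoc, ← mul_div_assoc, div_le_iff₀ hW]
    have hU' : 10 * τ * a * c / ε ≤ U - 40 * τ - 1 := by linarith
    rw [div_le_iff₀ hε] at hU'
    nlinarith
  have haω : a * ω = ε / 2 := by
    rw [hω_def]; field_simp
  have ha0 : 0 ≤ a := by linarith
  have hexp : a * (holeDensity L δ + ω + c * ((4 * τ * holeDensity L δ + τ) / (U - 40 * τ))) ≤
      a * holeDensity L δ + ε := by
    have := mul_le_mul_of_nonneg_left hrem ha0
    nlinarith
  exact h.trans hexp

end Summit.HubbardSuperconductivity.HubbardLadder.Bounds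

end
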